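import Summits.BirchSwinnertonDyer.BirchSwinnertonDyer.Theorems.ResidualThetaTransportAtTwoThetaLayerLambdaCongruenceAtTwoDepletion
import Literature.NumberTheory.EllipticCurves.PAdicLFunctionTameDepletionFactorProofs
import Literature.NumberTheory.EllipticCurves.PAdicMeasureUnsmoothingProofs
import HarnessLib

/-!
# Route `SignedLowerHalves`, crux L `SmallImageLowerHalfBothSigns` (item stmt-BirchSwinnertonDyer-23599), line `rtt_w3`,
# stub Kan₂ `stub_thetaLayerLambda_ns` — brick K1: the LAYER DEPLETION IDENTITY at an arbitrary prime `p`

Width seat `bsd-line-slh-p3-w3` g11 under LEAD `cruxlead-stmt-BirchSwinnertonDyer-23599` g0 (cell `bsd-ssimc`); STUB BRIEF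
`BRIEF-Kan2.md` (62e11156dfd76113). ROUTE-INDEPENDENT helper (`--supports stmt-BirchSwinnertonDyer-23599`); THEOREMS ONLY — no
definition, no named fact, no `sorry`; closes nothing; BSD is not proved by any of this.

WHAT. The `p`-generic port of the tree's `p = 2` file `…ThetaLayerLambdaCongruenceAtTwoDepletion`. With `e₀ = cyclotomicExponent p`,
`γ = cyclotomicGenerator p`, `μ = rootsOfUnity (torsionOrder p) ℤ_p`, the tree's Mazur–Tate elements are the `μ`-SUMMED layer sums
`ϑ_n(ψ) = ∑_{η∈μ} ∑_{s mod pⁿ} ψ((ηγ^s mod p^{n+e₀})/p^{n+e₀}) (1+X)^s` of a `1`-periodic `ψ : ℚ → R`. For `m` prime to `p` with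
`m ≡ ω(m)γ^F`, `ω(m) ∈ μ` (tree `exists_teichmuller_frobeniusExponent`), the layer sum of `x ↦ ψ(mx)` is `(1+X)^{−F}ϑ_n(ψ)` modulo
`ω_n = (1+X)^{pⁿ} − 1` (the factor `ω(m)` is absorbed by re-indexing `η ↦ ω(m)η`; no evenness of `ψ` needed). Hence for moduli `ℓ_a`
prime to `p`, polynomials `P_a` of degree `≤ d` and `e_a = (−f_{ℓ_a}) mod pⁿ`:
`ϑ_n(ψ)·∏_a P_a ∘ (ℓ_a⁻¹(1+X)^{e_a}) ≡ ϑ_n(ψ^{S}) (mod ω_n)`, `ψ^{S}(x) = ∑_{k : S → {0..d}} (∏_a coeff_{k_a}(P_a)ℓ_a^{−k_a})·ψ(x·∏_a ℓ_a^{k_a})`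
— the finite-layer form of `θ_n(f_{S}) = θ_n(f)·∏_ℓ P_ℓ(ℓ⁻¹σ_ℓ⁻¹)` (Greenberg–Vatsal §1 (8); Matsuno 2000 Lemma 3.3).

* §1 `layerSum_shift_congr'` — re-indexing a layer sum over `ℤ/q` (any modulus `q`).
* §2 `cyclotomicGenerator_pow_eq_pow_mod`, `apply_samplePoint_eq_mod`, `apply_mul_samplePoint`, `sum_apply_mul_samplePoint`,
  `layerSum_dilate_congr'` — the dilation lemma with the `μ`-sum.
* §3 `toZModPow_prod_pow_teichmuller`, `layerSum_mul_prod_eulerFactor_congr'` — THE DEPLETION IDENTITY modulo `ω_n`.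

References: [GreenbergVatsal2000] §1 p. 9 (display (8)); [Matsuno2000] Lemma 3.3; [MazurTateTeitelbaum1986Invent] §I.8, §I.13;
[PollackWeston2011MT] §2.1 (2.1).
-/

set_option autoImplicit false
-- D-0017: single-problem summit, the namespace repeats the problem name by design.
set_option linter.dupNamespace false
noncomputable section

open scoped Classical

open Polynomial Literature.NumberTheory.EllipticCurves Literature.NumberTheory.EllipticCurves.GreenbergVatsal2000
  Summit.BirchSwinnertonDyer.BirchSwinnertonDyer.Theorems.ThetaLayerLambdaCongruenceAtTwo

namespace Summit.BirchSwinnertonDyer.BirchSwinnertonDyer.Theorems.SmallImageRttKan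

/-! ## §1 Re-indexing a layer sum over `ℤ/q` -/

section Shift

variable {R : Type*} [CommRing R]

/-- **Re-indexing the layer sum** (any modulus `q`): for a `q`-periodic coefficient sequence `c` and `F + G ≡ 0 (mod q)`,
`∑_s c(s+F)(1+X)^s ≡ (1+X)^G ∑_s c(s)(1+X)^s (mod (1+X)^{q} − 1)` (substitute `s ↦ s + F`, `(1+X)^{s} ≡ (1+X)^{s+F+G}`).
Port of the tree's `layerSum_shift_congr` (`q = 2ⁿ`). [folklore] -/
theorem layerSum_shift_congr' (c : ℕ → R) {q : ℕ} [NeZero q] (hc : ∀ t, c t = c (t % q)) {F G : ℕ}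
    (hFG : q ∣ F + G) :
    ((X + 1) ^ q - 1 : R[X]) ∣
      (∑ s : ZMod q, C (c (s.val + F)) * (X + 1) ^ s.val) -
        (X + 1) ^ G * ∑ s : ZMod q, C (c s.val) * (X + 1) ^ s.val := by
  classical
  have hre : ∑ s : ZMod q, C (c s.val) * (X + 1 : R[X]) ^ s.val =
      ∑ s : ZMod q, C (c (s + (F : ZMod q)).val) * (X + 1) ^ (s + (F : ZMod q)).val := by
    rw [← Equiv.sum_comp (Equiv.addRight (F : ZMod q))]
    simp only [Equiv.coe_addRight]
  rw [hre, Finset.mul_sum, ← Finset.sum_sub_distrib]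
  refine Finset.dvd_sum fun s _ ↦ ?_
  have hval : (s + (F : ZMod q)).val % q = (s.val + F) % q := by
    rw [ZMod.val_add, ZMod.val_natCast, Nat.mod_mod, Nat.add_mod, Nat.mod_mod, ← Nat.add_mod]
  have hc' : c (s + (F : ZMod q)).val = c (s.val + F) := by
    rw [hc (s + (F : ZMod q)).val, hc (s.val + F), hval]
  have hexp : s.val ≡ G + (s + (F : ZMod q)).val [MOD q] := by
    have h1 : G + (s + (F : ZMod q)).val ≡ G + (s.val + F) [MOD q] := (Nat.ModEq.refl G).add hval
    have h2 : s.val + (F + G) ≡ s.val + 0 [MOD q] := (Nat.ModEq.refl _).add (Nat.modEq_zero_iff_dvd.mpr hFG)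
    rw [add_zero] at h2
    have h3 : G + (s.val + F) = s.val + (F + G) := by ring
    rw [h3] at h1
    exact (h1.trans h2).symm
  rw [hc', ← mul_assoc, mul_comm ((X + 1 : R[X]) ^ G) (C _), mul_assoc, ← pow_add, ← mul_sub]
  exact dvd_mul_of_dvd_right (layerModulus_dvd_pow_sub_pow_of_modEq hexp) _

end Shift

/-! ## §2 The `μ`-summed layer sum of a dilated periodic function: `ϑ_n([m]ψ) ≡ (1+X)^{−F}·ϑ_n(ψ)` -/

section Dilation

variable {p : ℕ} [hp : Fact p.Prime] {R : Type*} [CommRing R]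

/-- `γ^{t} = γ^{t mod pⁿ}` in `ℤ/p^{n+e₀}` (`γ` has order `pⁿ` there: tree `cyclotomicGenerator_pow_pow_eq_one`).
[cite: MazurTateTeitelbaum1986Invent, §I.13] -/
theorem cyclotomicGenerator_pow_eq_pow_mod (n t : ℕ) :
    (cyclotomicGenerator p : ZMod (p ^ (n + cyclotomicExponent p))) ^ t =
      (cyclotomicGenerator p : ZMod (p ^ (n + cyclotomicExponent p))) ^ (t % p ^ n) := by
  have h1 : (cyclotomicGenerator p : ZMod (p ^ (n + cyclotomicExponent p))) ^ p ^ n = 1 :=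
    cyclotomicGenerator_pow_pow_eq_one (p := p) n
  conv_lhs => rw [← Nat.div_add_mod t (p ^ n), pow_add, pow_mul, h1, one_pow, one_mul]

omit hp [CommRing R] in
/-- The sample value `ψ((η γ^t mod p^{n+e₀})/p^{n+e₀})` depends on `t` only modulo `pⁿ`. [cite: MazurTateTeitelbaum1986Invent, §I.13] -/
theorem apply_samplePoint_eq_mod [Fact p.Prime] (ψ : ℚ → R) (n : ℕ) (u : ZMod (p ^ (n + cyclotomicExponent p))) (t : ℕ) :
    ψ (((u * (cyclotomicGenerator p : ZMod (p ^ (n + cyclotomicExponent p))) ^ t).val : ℚ) /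
        (p : ℚ) ^ (n + cyclotomicExponent p)) =
      ψ (((u * (cyclotomicGenerator p : ZMod (p ^ (n + cyclotomicExponent p))) ^ (t % p ^ n)).val : ℚ) /
        (p : ℚ) ^ (n + cyclotomicExponent p)) := by
  rw [cyclotomicGenerator_pow_eq_pow_mod]

omit [CommRing R] in
/-- **Dilation by `m ≡ ω γ^F (mod p^{n+e₀})`** (`ω` the reduction of a Teichmüller representative): for a `1`-periodic
`ψ : ℚ → R`, `ψ(m · (ηγ^s)/p^{n+e₀}) = ψ(((ωη) γ^{s+F})/p^{n+e₀})` — the two arguments differ by an integer.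
[cite: MazurTateTeitelbaum1986Invent, §I.13 (x = η γ^{ℓ(x)})] -/
theorem apply_mul_samplePoint (ψ : ℚ → R) (hper : ∀ (x : ℚ) (k : ℤ), ψ (x + k) = ψ x) {n m F : ℕ}
    {ω : ZMod (p ^ (n + cyclotomicExponent p))}
    (hm : (m : ZMod (p ^ (n + cyclotomicExponent p))) =
      ω * (cyclotomicGenerator p : ZMod (p ^ (n + cyclotomicExponent p))) ^ F)
    (u : ZMod (p ^ (n + cyclotomicExponent p))) (s : ℕ) :
    ψ ((m : ℚ) * (((u * (cyclotomicGenerator p : ZMod (p ^ (n + cyclotomicExponent p))) ^ s).val : ℚ) /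
        (p : ℚ) ^ (n + cyclotomicExponent p))) =
      ψ (((ω * u * (cyclotomicGenerator p : ZMod (p ^ (n + cyclotomicExponent p))) ^ (s + F)).val : ℚ) /
        (p : ℚ) ^ (n + cyclotomicExponent p)) := by
  -- the two numerators `A = m·(uγ^s).val` and `B = (ω u γ^{s+F}).val`
  obtain ⟨A, hA⟩ : ∃ A : ℕ, A = m * (u * (cyclotomicGenerator p : ZMod (p ^ (n + cyclotomicExponent p))) ^ s).val :=
    ⟨_, rfl⟩
  obtain ⟨B, hB⟩ : ∃ B : ℕ,
      B = (ω * u * (cyclotomicGenerator p : ZMod (p ^ (n + cyclotomicExponent p))) ^ (s + F)).val := ⟨_, rfl⟩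
  obtain ⟨N, hN⟩ : ∃ N : ℕ, N = p ^ (n + cyclotomicExponent p) := ⟨_, rfl⟩
  haveI : NeZero N := ⟨by rw [hN]; exact pow_ne_zero _ hp.out.ne_zero⟩
  have hNq : ((p : ℚ) ^ (n + cyclotomicExponent p)) = (N : ℚ) := by rw [hN]; push_cast; ring
  have hN0 : (N : ℚ) ≠ 0 := by exact_mod_cast (NeZero.ne N)
  have hAq : (m : ℚ) * ((((u * (cyclotomicGenerator p : ZMod (p ^ (n + cyclotomicExponent p))) ^ s).val : ℕ) : ℚ) /
      (p : ℚ) ^ (n + cyclotomicExponent p)) = (A : ℚ) / (N : ℚ) := by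
    rw [hA, hNq]; push_cast; ring
  have hBq : ((((ω * u * (cyclotomicGenerator p : ZMod (p ^ (n + cyclotomicExponent p))) ^ (s + F)).val : ℕ) : ℚ) /
      (p : ℚ) ^ (n + cyclotomicExponent p)) = (B : ℚ) / (N : ℚ) := by
    rw [hB, hNq]
  rw [hAq, hBq]
  have hAcast : (A : ZMod (p ^ (n + cyclotomicExponent p))) = (B : ZMod (p ^ (n + cyclotomicExponent p))) := by
    rw [hA, hB, Nat.cast_mul, ZMod.natCast_zmod_val, ZMod.natCast_zmod_val, hm,
      pow_add (cyclotomicGenerator p : ZMod (p ^ (n + cyclotomicExponent p))) s F]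
    ring
  -- `A ≡ B (mod N)`: the two arguments differ by an integer
  rw [← hN, ZMod.natCast_eq_natCast_iff] at hAcast
  obtain ⟨k, hk⟩ := Nat.modEq_iff_dvd.mp hAcast
  have hk' : ((B : ℚ) - A) = (N : ℚ) * k := by exact_mod_cast hk
  have e : (A : ℚ) / N = (B : ℚ) / N + ((-k : ℤ) : ℚ) := by
    push_cast
    field_simp
    linear_combination -hk'
  rw [e, hper]

/-- **The `μ`-sum absorbs the Teichmüller factor**: for `ζ ∈ μ = rootsOfUnity (torsionOrder p) ℤ_p` and any `G`,
`∑_{η∈μ} G(ζ̄ · η̄) = ∑_{η∈μ} G(η̄)` (`η ↦ ζη` permutes `μ`; `̄` = reduction mod `p^{n+e₀}`). [folklore] -/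
theorem finsum_teichmuller_mul {n : ℕ} (ζ : rootsOfUnity (torsionOrder p) ℤ_[p])
    (G : ZMod (p ^ (n + cyclotomicExponent p)) → R) :
    ∑ᶠ η : rootsOfUnity (torsionOrder p) ℤ_[p],
        G (PadicInt.toZModPow (n + cyclotomicExponent p) ((ζ : ℤ_[p]ˣ) : ℤ_[p]) *
          PadicInt.toZModPow (n + cyclotomicExponent p) ((η : ℤ_[p]ˣ) : ℤ_[p])) =
      ∑ᶠ η : rootsOfUnity (torsionOrder p) ℤ_[p], G (PadicInt.toZModPow (n + cyclotomicExponent p) ((η : ℤ_[p]ˣ) : ℤ_[p])) := by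
  haveI := neZero_torsionOrder p
  haveI : Fintype (rootsOfUnity (torsionOrder p) ℤ_[p]) := Fintype.ofFinite _
  rw [finsum_eq_sum_of_fintype, finsum_eq_sum_of_fintype]
  refine Fintype.sum_equiv (Equiv.mulLeft ζ) _ _ fun η ↦ ?_
  have hco : (((Equiv.mulLeft ζ η : rootsOfUnity (torsionOrder p) ℤ_[p]) : ℤ_[p]ˣ) : ℤ_[p]) =
      ((ζ : ℤ_[p]ˣ) : ℤ_[p]) * ((η : ℤ_[p]ˣ) : ℤ_[p]) := rfl
  rw [hco, map_mul]

/-- **The `μ`-summed sample of a dilated function**: for `ψ` `1`-periodic and `m ≡ ζ̄ γ^F (mod p^{n+e₀})` with `ζ ∈ μ`,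
`∑_{η∈μ} ψ(m · (η̄γ^s)/p^{n+e₀}) = ∑_{η∈μ} ψ((η̄ γ^{s+F})/p^{n+e₀})`. [cite: MazurTateTeitelbaum1986Invent, §I.13] -/
theorem sum_apply_mul_samplePoint (ψ : ℚ → R) (hper : ∀ (x : ℚ) (k : ℤ), ψ (x + k) = ψ x) {n m F : ℕ}
    {ζ : rootsOfUnity (torsionOrder p) ℤ_[p]}
    (hm : (m : ZMod (p ^ (n + cyclotomicExponent p))) =
      PadicInt.toZModPow (n + cyclotomicExponent p) ((ζ : ℤ_[p]ˣ) : ℤ_[p]) *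
        (cyclotomicGenerator p : ZMod (p ^ (n + cyclotomicExponent p))) ^ F) (s : ℕ) :
    ∑ᶠ η : rootsOfUnity (torsionOrder p) ℤ_[p],
        ψ ((m : ℚ) * (((PadicInt.toZModPow (n + cyclotomicExponent p) ((η : ℤ_[p]ˣ) : ℤ_[p]) *
          (cyclotomicGenerator p : ZMod (p ^ (n + cyclotomicExponent p))) ^ s).val : ℚ) /
            (p : ℚ) ^ (n + cyclotomicExponent p))) =
      ∑ᶠ η : rootsOfUnity (torsionOrder p) ℤ_[p],
        ψ (((PadicInt.toZModPow (n + cyclotomicExponent p) ((η : ℤ_[p]ˣ) : ℤ_[p]) *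
          (cyclotomicGenerator p : ZMod (p ^ (n + cyclotomicExponent p))) ^ (s + F)).val : ℚ) /
            (p : ℚ) ^ (n + cyclotomicExponent p)) := by
  have h1 := fun η : rootsOfUnity (torsionOrder p) ℤ_[p] ↦
    apply_mul_samplePoint ψ hper hm (PadicInt.toZModPow (n + cyclotomicExponent p) ((η : ℤ_[p]ˣ) : ℤ_[p])) s
  simp_rw [h1]
  exact finsum_teichmuller_mul ζ (fun u ↦ ψ (((u *
    (cyclotomicGenerator p : ZMod (p ^ (n + cyclotomicExponent p))) ^ (s + F)).val : ℚ) /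
      (p : ℚ) ^ (n + cyclotomicExponent p)))

/-- **The `μ`-summed layer sum of a dilated function**: for `ψ : ℚ → R` `1`-periodic, `m ≡ ζ̄ γ^F (mod p^{n+e₀})`
with `ζ ∈ μ`, and any `G` with `F + G ≡ 0 (mod pⁿ)`,
`∑_s (∑_η ψ(m·η̄γ^s/p^{n+e₀}))(1+X)^s ≡ (1+X)^G · ∑_s (∑_η ψ(η̄γ^s/p^{n+e₀}))(1+X)^s (mod (1+X)^{pⁿ} − 1)` —
`ϑ_n([m]ψ) = σ_m⁻¹ ϑ_n(ψ)` in `R[G_n]`, the finite-layer form of `θ_n(f | [ℓ]) = σ_ℓ⁻¹ θ_n(f)`.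
[cite: GreenbergVatsal2000, §1 p. 9 (display (8))] [cite: MazurTateTeitelbaum1986Invent, §I.13] -/
theorem layerSum_dilate_congr' (ψ : ℚ → R) (hper : ∀ (x : ℚ) (k : ℤ), ψ (x + k) = ψ x) {n m F G : ℕ}
    {ζ : rootsOfUnity (torsionOrder p) ℤ_[p]}
    (hm : (m : ZMod (p ^ (n + cyclotomicExponent p))) =
      PadicInt.toZModPow (n + cyclotomicExponent p) ((ζ : ℤ_[p]ˣ) : ℤ_[p]) *
        (cyclotomicGenerator p : ZMod (p ^ (n + cyclotomicExponent p))) ^ F)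
    (hFG : p ^ n ∣ F + G) :
    ((X + 1) ^ p ^ n - 1 : R[X]) ∣
      (∑ s : ZMod (p ^ n), C (∑ᶠ η : rootsOfUnity (torsionOrder p) ℤ_[p],
          ψ ((m : ℚ) * (((PadicInt.toZModPow (n + cyclotomicExponent p) ((η : ℤ_[p]ˣ) : ℤ_[p]) *
            (cyclotomicGenerator p : ZMod (p ^ (n + cyclotomicExponent p))) ^ s.val).val : ℚ) /
              (p : ℚ) ^ (n + cyclotomicExponent p)))) * (X + 1) ^ s.val) -
        (X + 1) ^ G * ∑ s : ZMod (p ^ n), C (∑ᶠ η : rootsOfUnity (torsionOrder p) ℤ_[p],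
          ψ (((PadicInt.toZModPow (n + cyclotomicExponent p) ((η : ℤ_[p]ˣ) : ℤ_[p]) *
            (cyclotomicGenerator p : ZMod (p ^ (n + cyclotomicExponent p))) ^ s.val).val : ℚ) /
              (p : ℚ) ^ (n + cyclotomicExponent p))) * (X + 1) ^ s.val := by
  haveI : NeZero (p ^ n) := ⟨pow_ne_zero _ hp.out.ne_zero⟩
  have h1 : (∑ s : ZMod (p ^ n), C (∑ᶠ η : rootsOfUnity (torsionOrder p) ℤ_[p],
          ψ ((m : ℚ) * (((PadicInt.toZModPow (n + cyclotomicExponent p) ((η : ℤ_[p]ˣ) : ℤ_[p]) *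
            (cyclotomicGenerator p : ZMod (p ^ (n + cyclotomicExponent p))) ^ s.val).val : ℚ) /
              (p : ℚ) ^ (n + cyclotomicExponent p)))) * (X + 1 : R[X]) ^ s.val) =
      ∑ s : ZMod (p ^ n), C (∑ᶠ η : rootsOfUnity (torsionOrder p) ℤ_[p],
          ψ (((PadicInt.toZModPow (n + cyclotomicExponent p) ((η : ℤ_[p]ˣ) : ℤ_[p]) *
            (cyclotomicGenerator p : ZMod (p ^ (n + cyclotomicExponent p))) ^ (s.val + F)).val : ℚ) /
              (p : ℚ) ^ (n + cyclotomicExponent p))) * (X + 1) ^ s.val :=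
    Finset.sum_congr rfl fun s _ ↦ by rw [sum_apply_mul_samplePoint ψ hper hm s.val]
  rw [h1]
  exact layerSum_shift_congr' (fun t ↦ ∑ᶠ η : rootsOfUnity (torsionOrder p) ℤ_[p],
      ψ (((PadicInt.toZModPow (n + cyclotomicExponent p) ((η : ℤ_[p]ˣ) : ℤ_[p]) *
        (cyclotomicGenerator p : ZMod (p ^ (n + cyclotomicExponent p))) ^ t).val : ℚ) /
          (p : ℚ) ^ (n + cyclotomicExponent p)))
    (fun t ↦ finsum_congr fun η ↦ apply_samplePoint_eq_mod ψ n _ t) hFG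

end Dilation

/-! ## §3 Teichmüller data of products and the depletion identity modulo `ω_n` -/

section Depletion

variable {p : ℕ} [hp : Fact p.Prime]

/-- **Teichmüller data of a product**: if `ℓ_a ≡ ζ̄_a γ^{f_a} (mod p^{n+e₀})` for `a ∈ S` then
`∏_a ℓ_a^{k_a} ≡ (∏_a ζ_a^{k_a})̄ · γ^{∑ k_a f_a}`, with `∏_a ζ_a^{k_a} ∈ μ`. [folklore] -/
theorem natCast_prod_pow_eq_teichmuller_mul_pow {α : Type*} (S : Finset α) (ℓ : α → ℕ) {n : ℕ}
    (ζ : α → rootsOfUnity (torsionOrder p) ℤ_[p]) (f : α → ℕ)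
    (hζ : ∀ a ∈ S, (ℓ a : ZMod (p ^ (n + cyclotomicExponent p))) =
      PadicInt.toZModPow (n + cyclotomicExponent p) ((ζ a : ℤ_[p]ˣ) : ℤ_[p]) *
        (cyclotomicGenerator p : ZMod (p ^ (n + cyclotomicExponent p))) ^ f a) (k : α → ℕ) :
    ((∏ a ∈ S, ℓ a ^ k a : ℕ) : ZMod (p ^ (n + cyclotomicExponent p))) =
      PadicInt.toZModPow (n + cyclotomicExponent p) (((∏ a ∈ S, ζ a ^ k a : rootsOfUnity (torsionOrder p) ℤ_[p]) : ℤ_[p]ˣ) : ℤ_[p]) *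
        (cyclotomicGenerator p : ZMod (p ^ (n + cyclotomicExponent p))) ^ (∑ a ∈ S, k a * f a) := by
  classical
  induction S using Finset.induction_on with
  | empty => simp
  | insert b S hb ih =>
    rw [Finset.prod_insert hb, Finset.prod_insert hb, Finset.sum_insert hb, Nat.cast_mul,
      ih (fun a ha ↦ hζ a (Finset.mem_insert_of_mem ha)), Nat.cast_pow, hζ b (Finset.mem_insert_self b S),
      Subgroup.coe_mul, Units.val_mul, map_mul, Subgroup.coe_pow, Units.val_pow_eq_pow_val, map_pow,
      pow_add (cyclotomicGenerator p : ZMod (p ^ (n + cyclotomicExponent p))) (k b * f b),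
      mul_pow, ← pow_mul, mul_comm (f b) (k b)]
    ring

variable {K : Type*} [Field K]

/-- **THE DEPLETION IDENTITY MODULO `ω_n` (any prime `p`).** Let `ψ : ℚ → K` be `1`-periodic, `S` a finite set of indices
with moduli `ℓ_a` prime to `p`, `P_a ∈ K[X]` of degree `≤ d`, and `e_a = (−f_{ℓ_a}) mod pⁿ` (`f_ℓ = frobeniusExponent p ℓ`,
so `(1+X)^{e_a} = σ_{ℓ_a}⁻¹` in the layer group ring). Then, with the `μ`-summed layer sum
`ϑ_n(ψ) = ∑_{s mod pⁿ} (∑_{η∈μ} ψ(η̄γ^s/p^{n+e₀})) (1+X)^s`,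

  `ϑ_n(ψ) · ∏_{a∈S} P_a ∘ (ℓ_a⁻¹ (1+X)^{e_a}) ≡ ϑ_n(ψ^{S})  (mod (1+X)^{pⁿ} − 1)`,
  `ψ^{S}(x) = ∑_{k : S → {0,…,d}} (∏_a coeff_{k_a}(P_a)·ℓ_a^{−k_a}) · ψ(x · ∏_a ℓ_a^{k_a})`

(the depletion operator `∏_a P_a(ℓ_a⁻¹ [ℓ_a])` applied to `ψ`) — the finite-layer form of
`θ_n(f | ∏_ℓ P_ℓ(ℓ⁻¹V_ℓ)) = θ_n(f) · ∏_ℓ P_ℓ(ℓ⁻¹σ_ℓ⁻¹)` (Greenberg–Vatsal §1 (8); Matsuno 2000 Lemma 3.3). Port of the tree's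
`p = 2` theorem `ThetaLayerLambdaCongruenceAtTwo.layerSum_mul_prod_eulerFactor_congr`.
[cite: GreenbergVatsal2000, §1 p. 9 (display (8))] [cite: Matsuno2000, Lemma 3.3] -/
theorem layerSum_mul_prod_eulerFactor_congr' (ψ : ℚ → K) (hper : ∀ (x : ℚ) (k : ℤ), ψ (x + k) = ψ x)
    {α : Type*} (S : Finset α) (ℓ : α → ℕ) (hcop : ∀ a ∈ S, (ℓ a).Coprime p) (P : α → K[X]) {d : ℕ}
    (hd : ∀ a ∈ S, (P a).natDegree ≤ d) (n : ℕ) :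
    ((X + 1) ^ p ^ n - 1 : K[X]) ∣
      (∑ s : ZMod (p ^ n), C (∑ᶠ η : rootsOfUnity (torsionOrder p) ℤ_[p],
          ψ (((PadicInt.toZModPow (n + cyclotomicExponent p) ((η : ℤ_[p]ˣ) : ℤ_[p]) *
            (cyclotomicGenerator p : ZMod (p ^ (n + cyclotomicExponent p))) ^ s.val).val : ℚ) /
              (p : ℚ) ^ (n + cyclotomicExponent p))) * (X + 1) ^ s.val) *
        ∏ a ∈ S, (P a).comp (C ((ℓ a : K)⁻¹) * (X + 1) ^
          (PadicInt.toZModPow n (-(frobeniusExponent p (ℓ a : ℤ_[p])))).val) -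
      ∑ s : ZMod (p ^ n), C (∑ᶠ η : rootsOfUnity (torsionOrder p) ℤ_[p],
          (∑ k ∈ Fintype.piFinset (fun _ : S ↦ Finset.range (d + 1)),
            (∏ a : S, (P a).coeff (k a) * ((ℓ a : K)⁻¹) ^ (k a)) *
              ψ ((((PadicInt.toZModPow (n + cyclotomicExponent p) ((η : ℤ_[p]ˣ) : ℤ_[p]) *
                (cyclotomicGenerator p : ZMod (p ^ (n + cyclotomicExponent p))) ^ s.val).val : ℚ) /
                  (p : ℚ) ^ (n + cyclotomicExponent p)) * ((∏ a : S, ℓ a ^ (k a) : ℕ) : ℚ)))) *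
        (X + 1) ^ s.val := by
  classical
  haveI : NeZero (p ^ n) := ⟨pow_ne_zero _ hp.out.ne_zero⟩
  -- abbreviations: exponents `e a`, `f a`
  obtain ⟨e, he⟩ : ∃ e : α → ℕ, ∀ a, e a =
      (PadicInt.toZModPow n (-(frobeniusExponent p (ℓ a : ℤ_[p])))).val := ⟨_, fun _ ↦ rfl⟩
  obtain ⟨f, hf⟩ : ∃ f : α → ℕ, ∀ a, f a =
      (PadicInt.toZModPow n (frobeniusExponent p (ℓ a : ℤ_[p]))).val := ⟨_, fun _ ↦ rfl⟩
  simp only [← he]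
  -- Teichmüller data `ℓ_a ≡ ζ̄_a γ^{f_a}`
  have hteich : ∀ a ∈ S, ∃ ζ : rootsOfUnity (torsionOrder p) ℤ_[p],
      (ℓ a : ZMod (p ^ (n + cyclotomicExponent p))) =
        PadicInt.toZModPow (n + cyclotomicExponent p) ((ζ : ℤ_[p]ˣ) : ℤ_[p]) *
          (cyclotomicGenerator p : ZMod (p ^ (n + cyclotomicExponent p))) ^ f a := by
    intro a ha
    obtain ⟨ζ, hζ⟩ := exists_teichmuller_frobeniusExponent (p := p) (hcop a ha)
    exact ⟨ζ, by rw [hf]; exact (hζ n).symm⟩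
  choose! ζ hζ using hteich
  have hfe : ∀ a, p ^ n ∣ f a + e a := by
    intro a
    rw [hf, he, map_neg]
    exact dvd_val_add_val_neg _
  -- expand the product of Euler factors over `k : S → {0..d}`
  have hprod : ∏ a ∈ S, (P a).comp (C ((ℓ a : K)⁻¹) * (X + 1) ^ e a) =
      ∑ k ∈ Fintype.piFinset (fun _ : S ↦ Finset.range (d + 1)),
        C (∏ a : S, (P a).coeff (k a) * ((ℓ a : K)⁻¹) ^ (k a)) * (X + 1) ^ (∑ a : S, k a * e a) := by
    rw [← Finset.prod_coe_sort S]
    have hcomp : ∀ a : S, (P a).comp (C ((ℓ a : K)⁻¹) * (X + 1) ^ e a) =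
        ∑ k ∈ Finset.range (d + 1), C ((P a).coeff k * ((ℓ a : K)⁻¹) ^ k) * (X + 1) ^ (k * e a) := by
      intro a
      rw [comp_eq_sum_range_of_natDegree_le (hd a a.2)]
      refine Finset.sum_congr rfl fun k _ ↦ ?_
      rw [mul_pow, ← map_pow, ← pow_mul, ← mul_assoc, ← map_mul, mul_comm (e a) k]
    simp_rw [hcomp]
    rw [Finset.prod_univ_sum]
    refine Finset.sum_congr rfl fun k _ ↦ ?_
    rw [Finset.prod_mul_distrib, ← map_prod, Finset.prod_pow_eq_pow_sum]
  rw [hprod, Finset.mul_sum]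
  -- the depleted layer sum, expanded over `k`
  have hdep : (∑ s : ZMod (p ^ n), C (∑ᶠ η : rootsOfUnity (torsionOrder p) ℤ_[p],
          (∑ k ∈ Fintype.piFinset (fun _ : S ↦ Finset.range (d + 1)),
            (∏ a : S, (P a).coeff (k a) * ((ℓ a : K)⁻¹) ^ (k a)) *
              ψ ((((PadicInt.toZModPow (n + cyclotomicExponent p) ((η : ℤ_[p]ˣ) : ℤ_[p]) *
                (cyclotomicGenerator p : ZMod (p ^ (n + cyclotomicExponent p))) ^ s.val).val : ℚ) /
                  (p : ℚ) ^ (n + cyclotomicExponent p)) * ((∏ a : S, ℓ a ^ (k a) : ℕ) : ℚ)))) *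
        (X + 1 : K[X]) ^ s.val) =
      ∑ k ∈ Fintype.piFinset (fun _ : S ↦ Finset.range (d + 1)),
        C (∏ a : S, (P a).coeff (k a) * ((ℓ a : K)⁻¹) ^ (k a)) *
          ∑ s : ZMod (p ^ n), C (∑ᶠ η : rootsOfUnity (torsionOrder p) ℤ_[p],
            ψ (((∏ a : S, ℓ a ^ (k a) : ℕ) : ℚ) *
              (((PadicInt.toZModPow (n + cyclotomicExponent p) ((η : ℤ_[p]ˣ) : ℤ_[p]) *
                (cyclotomicGenerator p : ZMod (p ^ (n + cyclotomicExponent p))) ^ s.val).val : ℚ) /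
                  (p : ℚ) ^ (n + cyclotomicExponent p)))) * (X + 1) ^ s.val := by
    haveI := neZero_torsionOrder p
    haveI : Fintype (rootsOfUnity (torsionOrder p) ℤ_[p]) := Fintype.ofFinite _
    have inner : ∀ s : ZMod (p ^ n), (∑ᶠ η : rootsOfUnity (torsionOrder p) ℤ_[p],
          (∑ k ∈ Fintype.piFinset (fun _ : S ↦ Finset.range (d + 1)),
            (∏ a : S, (P a).coeff (k a) * ((ℓ a : K)⁻¹) ^ (k a)) *
              ψ ((((PadicInt.toZModPow (n + cyclotomicExponent p) ((η : ℤ_[p]ˣ) : ℤ_[p]) *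
                (cyclotomicGenerator p : ZMod (p ^ (n + cyclotomicExponent p))) ^ s.val).val : ℚ) /
                  (p : ℚ) ^ (n + cyclotomicExponent p)) * ((∏ a : S, ℓ a ^ (k a) : ℕ) : ℚ)))) =
        ∑ k ∈ Fintype.piFinset (fun _ : S ↦ Finset.range (d + 1)),
          (∏ a : S, (P a).coeff (k a) * ((ℓ a : K)⁻¹) ^ (k a)) *
            ∑ᶠ η : rootsOfUnity (torsionOrder p) ℤ_[p],
              ψ (((∏ a : S, ℓ a ^ (k a) : ℕ) : ℚ) *
                (((PadicInt.toZModPow (n + cyclotomicExponent p) ((η : ℤ_[p]ˣ) : ℤ_[p]) *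
                  (cyclotomicGenerator p : ZMod (p ^ (n + cyclotomicExponent p))) ^ s.val).val : ℚ) /
                    (p : ℚ) ^ (n + cyclotomicExponent p))) := by
      intro s
      rw [finsum_eq_sum_of_fintype, Finset.sum_comm]
      refine Finset.sum_congr rfl fun k _ ↦ ?_
      rw [finsum_eq_sum_of_fintype, Finset.mul_sum]
      refine Finset.sum_congr rfl fun η _ ↦ ?_
      rw [mul_comm ((((PadicInt.toZModPow (n + cyclotomicExponent p) ((η : ℤ_[p]ˣ) : ℤ_[p]) *
        (cyclotomicGenerator p : ZMod (p ^ (n + cyclotomicExponent p))) ^ s.val).val : ℚ) /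
          (p : ℚ) ^ (n + cyclotomicExponent p)))]
    have step : ∀ s : ZMod (p ^ n), C (∑ᶠ η : rootsOfUnity (torsionOrder p) ℤ_[p],
          (∑ k ∈ Fintype.piFinset (fun _ : S ↦ Finset.range (d + 1)),
            (∏ a : S, (P a).coeff (k a) * ((ℓ a : K)⁻¹) ^ (k a)) *
              ψ ((((PadicInt.toZModPow (n + cyclotomicExponent p) ((η : ℤ_[p]ˣ) : ℤ_[p]) *
                (cyclotomicGenerator p : ZMod (p ^ (n + cyclotomicExponent p))) ^ s.val).val : ℚ) /
                  (p : ℚ) ^ (n + cyclotomicExponent p)) * ((∏ a : S, ℓ a ^ (k a) : ℕ) : ℚ)))) *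
        (X + 1 : K[X]) ^ s.val =
        ∑ k ∈ Fintype.piFinset (fun _ : S ↦ Finset.range (d + 1)),
          C (∏ a : S, (P a).coeff (k a) * ((ℓ a : K)⁻¹) ^ (k a)) *
            (C (∑ᶠ η : rootsOfUnity (torsionOrder p) ℤ_[p],
              ψ (((∏ a : S, ℓ a ^ (k a) : ℕ) : ℚ) *
                (((PadicInt.toZModPow (n + cyclotomicExponent p) ((η : ℤ_[p]ˣ) : ℤ_[p]) *
                  (cyclotomicGenerator p : ZMod (p ^ (n + cyclotomicExponent p))) ^ s.val).val : ℚ) /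
                    (p : ℚ) ^ (n + cyclotomicExponent p)))) * (X + 1 : K[X]) ^ s.val) := by
      intro s
      rw [inner s, map_sum, Finset.sum_mul]
      refine Finset.sum_congr rfl fun k _ ↦ ?_
      rw [map_mul, mul_assoc]
    rw [Finset.sum_congr rfl fun s _ ↦ step s, Finset.sum_comm]
    refine Finset.sum_congr rfl fun k _ ↦ ?_
    rw [Finset.mul_sum]
  rw [hdep, ← Finset.sum_sub_distrib]
  refine Finset.dvd_sum fun k hk ↦ ?_
  rw [mul_left_comm, ← mul_sub]
  refine dvd_mul_of_dvd_right ?_ _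
  -- Teichmüller data for `m_k = ∏ ℓ_a^{k_a}`
  have hm := natCast_prod_pow_eq_teichmuller_mul_pow (p := p) (Finset.univ : Finset S) (fun a ↦ ℓ a) (n := n)
    (fun a ↦ ζ a) (fun a ↦ f a) (fun a _ ↦ hζ a a.2) k
  have hFG : p ^ n ∣ (∑ a : S, k a * f a) + ∑ a : S, k a * e a := by
    rw [← Finset.sum_add_distrib]
    exact Finset.dvd_sum fun a _ ↦ by rw [← mul_add]; exact (hfe a).mul_left _
  have h := layerSum_dilate_congr' (R := K) ψ hper hm hFG
  rw [mul_comm ((X + 1 : K[X]) ^ (∑ a : S, k a * e a))] at h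
  rwa [← dvd_neg, neg_sub] at h

end Depletion

end Summit.BirchSwinnertonDyer.BirchSwinnertonDyer.Theorems.SmallImageRttKan

end
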